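import Literature.NumberTheory.EllipticCurves.FormalGroupNilIdealPoints
import Literature.NumberTheory.EllipticCurves.FormalGroupMultiplicationPrimeDecompositionInt
import Mathlib.Analysis.Normed.Group.Ultra
import Mathlib.Analysis.SpecificLimits.Basic
import HarnessLib

/-!
# Saturation of approximate `[p]`-division sequences of a formal group over `𝒪_ℂ`: every sequence `v` with
# `[p]v_{n+1} ≡ v_n` (to within `δ < 1`) is `δ`-close to a UNIQUE exact division sequence `w` (`[p]w_{n+1} = w_n`)

Topic `Literature/NumberTheory/PAdicHodge` (theorems only; no definition, no named fact, no instance, no `sorry`). Let `K` be a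
complete non-archimedean field with closed unit ball `𝒪_K = unitBall K` and open unit ball `𝔪_K` (`ballNilIdeal K`; for `K = ℂ_F`
the tree's `maxNilIdealC F`), and `W/ℤ` an integral Weierstrass equation with multiplication-by-`p` series `[p] = [p]_W ∈ ℤ⟦X⟧`
(`W.formalMul p`), acting on `Ŵ(𝔪_K)` by evaluation (`evalPt₁`; on `𝔪_{ℂ_F}` this is LITERALLY the tree's `AinfTop.mulPC F p W`).

* §1 LIPSCHITZ ESTIMATES: `‖h(x) − h(y)‖ ≤ ‖x − y‖` for every `h ∈ A⟦X⟧` (`norm_evalAt_sub_evalAt_le`) and the two-variable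
  analogue for `G ∈ A⟦X, Y⟧` (`norm_evalPt_two_sub_le`; so `⊕_W` is `1`-Lipschitz in each variable);
* §2 CONTRACTION OF `[p]` (AEC IV.4.4 `[p] = p·f + g(Xᵖ)` over `ℤ`, tree `formalMul_prime_eq_add_subst_X_pow_int`):
  **`‖[p]x − [p]y‖ ≤ max(‖p‖·‖x − y‖, ‖x − y‖ᵖ)`** (`norm_formalMul_sub_le_max`), hence `‖[p]ᵏx − [p]ᵏy‖ ≤ ρᵏ·δ` with
  `ρ = max(‖p‖, δ^{p−1}) < 1` whenever `‖x − y‖ ≤ δ < 1` (`norm_iterate_formalMul_sub_le`);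
* §3 ★★ SATURATION (`exists_divisionSeq_norm_sub_le`, `divisionSeq_unique_of_norm_sub_le`): if `‖[p]v_{n+1} − v_n‖ ≤ δ < 1` for
  all `n` then `w_n := lim_k [p]ᵏ(v_{n+k})` exists, `[p]w_{n+1} = w_n` EXACTLY and `‖w_n − v_n‖ ≤ δ`; and an exact division sequence
  `δ`-close to `v` is unique — two exact division sequences which are termwise `δ`-close are EQUAL (rigidity of `[p]`-towers);
* the sequel `AinfWeierstrassDivisionSaturation` restates §3 verbatim on `𝔪_{ℂ_F}` for the φ-road's `AinfTop.mulPC F p W`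
  and adds the compatibilities with the Galois action and with the formal-group sum.

Purpose (line `kato_lever`, crux K★ `stmt-BirchSwinnertonDyer-22226`, memo
`Cruxes/StarredOptimalManinUnitFiveSeven/Lines/kato-lever-K2-ramified-cm-transport.md`): the «CM-fibre transport» road to
(K₂) over a RAMIFIED base. The good `𝒪_L`-model `W_L` of a K★ cell (`L = ℚ_p(p^{1/e})`) agrees modulo `ϖ` with a
`ℤ`-curve `E₀` of good reduction, so every `[p]_{W_L}`-division sequence of `Ŵ_L(𝔪_ℂ)` is an APPROXIMATE
`[p]_{E₀}`-division sequence (`δ = ‖ϖ‖`); its saturation is an EXACT `[p]_{E₀}`-division sequence, to which the whole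
unramified φ-road (`BmaxPlusFormalLogDivisionTower`, `BmaxPlusFormalLogKTwo`, …) applies. BSD / K★ are not proved
by any of this; nothing about elliptic curves over number fields is proved here.

## References
* J. H. Silverman, *The Arithmetic of Elliptic Curves* (2009), IV.2.3, IV.3.2, IV.4.4. [SilvermanAEC2009]
* J.-P. Serre, *Local class field theory* (Cassels–Fröhlich Ch. VI) §3.2 (points of formal groups with values in `𝔪`). [CasselsFrohlichANT1967]
* P. Colmez, *Périodes p-adiques des variétés abéliennes*, Math. Ann. 292 (1992), §2 (limits `lim [pⁿ](·)` of lifted division points). [Colmez1992PeriodesAbeliennes]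
* N. M. Katz, *Crystalline cohomology, Dieudonné modules, and Jacobi sums* (1981), Thm. 5.1.4. [Katz1981CrystallineDieudonne]
-/

noncomputable section

open PowerSeries Filter Topology
open scoped Classical

namespace Literature.NumberTheory.PAdicHodge
open Literature.NumberTheory.GaloisRepresentations.LubinTate Literature.NumberTheory.EllipticCurves

/-! ## §1 Lipschitz estimates for evaluation of integral series at points of `𝔪_K` -/

section Lipschitz

variable {K : Type*} [NontriviallyNormedField K] [IsUltrametricDist K] [CompleteSpace K]
  {A : Type*} [CommRing A] [UniformSpace A] [DiscreteUniformity A]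
  [Algebra A (unitBall K)] [ContinuousSMul A (unitBall K)]

omit [CompleteSpace K] in
/-- `‖xᵈ − yᵈ‖ ≤ ‖x − y‖` in `𝒪_K` (`x − y ∣ xᵈ − yᵈ` with an integral quotient). [cite: CasselsFrohlichANT1967, Ch. VI §3.2] -/
theorem norm_coe_pow_sub_pow_le (x y : unitBall K) (d : ℕ) :
    ‖((x ^ d - y ^ d : unitBall K) : K)‖ ≤ ‖((x : K) - (y : K))‖ := by
  obtain ⟨c, hc⟩ := sub_dvd_pow_sub_pow x y d
  rw [hc]
  push_cast
  rw [norm_mul]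
  exact mul_le_of_le_one_right (norm_nonneg _) ((mem_unitBall_iff K).mp c.2)

omit [CompleteSpace K] [UniformSpace A] [DiscreteUniformity A] [ContinuousSMul A (unitBall K)] in
/-- Coefficients act with norm `≤ 1`: `‖ι(a)·z‖ ≤ ‖z‖`. [cite: CasselsFrohlichANT1967, Ch. VI §3.2] -/
theorem norm_coe_algebraMap_mul_le (a : A) (z : K) : ‖((algebraMap A (unitBall K) a : unitBall K) : K) * z‖ ≤ ‖z‖ := by
  rw [norm_mul]
  exact mul_le_of_le_one_left (norm_nonneg _) ((mem_unitBall_iff K).mp (algebraMap A (unitBall K) a).2)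

/-- ★ **`‖h(x) − h(y)‖ ≤ ‖x − y‖`** for every `h ∈ A⟦X⟧` and `x, y ∈ 𝔪_K`: evaluation of an integral series is
`1`-Lipschitz (termwise `‖a_d‖·‖xᵈ − yᵈ‖ ≤ ‖x − y‖`, ultrametric sum). [cite: CasselsFrohlichANT1967, Ch. VI §3.2] -/
theorem norm_evalAt_sub_evalAt_le (x y : (ballNilIdeal K).toIdeal) (h : PowerSeries A) :
    ‖((evalAt (ballNilIdeal K) x h : unitBall K) : K) - ((evalAt (ballNilIdeal K) y h : unitBall K) : K)‖ ≤
      ‖(((x : unitBall K)) : K) - ((y : unitBall K) : K)‖ := by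
  have hx := PowerSeries.hasSum_aeval ((ballNilIdeal K).isTopologicallyNilpotent _ x.2) h
  have hy := PowerSeries.hasSum_aeval ((ballNilIdeal K).isTopologicallyNilpotent _ y.2) h
  have hxy := (hx.sub hy).map (unitBall K).subtype continuous_subtype_val
  rw [Subring.coe_subtype] at hxy
  rw [evalAt_apply, evalAt_apply, ← AddSubgroupClass.coe_sub, ← hxy.tsum_eq]
  refine IsUltrametricDist.norm_tsum_le_of_forall_le_of_nonneg (norm_nonneg _) fun d => ?_
  rw [Function.comp_apply, ← smul_sub, Algebra.smul_def]
  push_cast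
  refine (norm_coe_algebraMap_mul_le _ _).trans ?_
  have := norm_coe_pow_sub_pow_le (x : unitBall K) (y : unitBall K) d
  push_cast at this
  exact this

/-- The point version: `‖g(x) − g(y)‖ ≤ ‖x − y‖` for the `𝔪_K`-valued evaluation `evalPt₁` of a series without
constant term. [cite: CasselsFrohlichANT1967, Ch. VI §3.2] -/
theorem norm_evalPt₁_sub_evalPt₁_le (g : PowerSeries A) (hg : PowerSeries.constantCoeff g = 0)
    (x y : (ballNilIdeal K).toIdeal) :
    ‖(((evalPt₁ (ballNilIdeal K) g hg x : (ballNilIdeal K).toIdeal) : unitBall K) : K) -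
        (((evalPt₁ (ballNilIdeal K) g hg y : (ballNilIdeal K).toIdeal) : unitBall K) : K)‖ ≤
      ‖(((x : unitBall K)) : K) - ((y : unitBall K) : K)‖ := by
  rw [coe_evalPt₁_eq_evalAt, coe_evalPt₁_eq_evalAt]
  exact norm_evalAt_sub_evalAt_le x y g

omit [CompleteSpace K] [UniformSpace A] [DiscreteUniformity A] [Algebra A (unitBall K)] [ContinuousSMul A (unitBall K)] in
/-- Two-variable monomials: `‖x₀ᵃx₁ᵇ − y₀ᵃy₁ᵇ‖ ≤ max(‖x₀ − y₀‖, ‖x₁ − y₁‖)` in `𝒪_K`. [cite: CasselsFrohlichANT1967, Ch. VI §3.2] -/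
theorem norm_coe_monomial_two_sub_le (x y : Fin 2 → unitBall K) (a b : ℕ) :
    ‖(((x 0) ^ a * (x 1) ^ b - (y 0) ^ a * (y 1) ^ b : unitBall K) : K)‖ ≤
      max ‖((x 0 : unitBall K) : K) - (y 0 : unitBall K)‖ ‖((x 1 : unitBall K) : K) - (y 1 : unitBall K)‖ := by
  have hsplit : ((x 0) ^ a * (x 1) ^ b - (y 0) ^ a * (y 1) ^ b : unitBall K) =
      ((x 0) ^ a - (y 0) ^ a) * (x 1) ^ b + (y 0) ^ a * ((x 1) ^ b - (y 1) ^ b) := by ring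
  rw [hsplit]
  push_cast
  refine (IsUltrametricDist.norm_add_le_max _ _).trans (max_le_max ?_ ?_)
  · rw [norm_mul]
    refine (mul_le_of_le_one_right (norm_nonneg _) ?_).trans ?_
    · rw [← SubmonoidClass.coe_pow]; exact (mem_unitBall_iff K).mp ((x 1) ^ b).2
    · have := norm_coe_pow_sub_pow_le (x 0) (y 0) a
      push_cast at this
      exact this
  · rw [norm_mul]
    refine (mul_le_of_le_one_left (norm_nonneg _) ?_).trans ?_
    · rw [← SubmonoidClass.coe_pow]; exact (mem_unitBall_iff K).mp ((y 0) ^ a).2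
    · have := norm_coe_pow_sub_pow_le (x 1) (y 1) b
      push_cast at this
      exact this

/-- ★ **`‖G(x₀, x₁) − G(y₀, y₁)‖ ≤ max(‖x₀ − y₀‖, ‖x₁ − y₁‖)`** for `G ∈ A⟦X₀, X₁⟧` without constant term: two-variable
evaluation (`evalPt`, e.g. a formal group law) is `1`-Lipschitz in each variable. [cite: CasselsFrohlichANT1967, Ch. VI §3.2] -/
theorem norm_evalPt_two_sub_le (G : MvPowerSeries (Fin 2) A) (hG : MvPowerSeries.constantCoeff G = 0)
    (x y : Fin 2 → (ballNilIdeal K).toIdeal) :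
    ‖(((evalPt (ballNilIdeal K) G hG x : (ballNilIdeal K).toIdeal) : unitBall K) : K) -
        (((evalPt (ballNilIdeal K) G hG y : (ballNilIdeal K).toIdeal) : unitBall K) : K)‖ ≤
      max ‖(((x 0 : (ballNilIdeal K).toIdeal) : unitBall K) : K) - ((y 0 : (ballNilIdeal K).toIdeal) : unitBall K)‖
        ‖(((x 1 : (ballNilIdeal K).toIdeal) : unitBall K) : K) - ((y 1 : (ballNilIdeal K).toIdeal) : unitBall K)‖ := by
  have hx := MvPowerSeries.hasSum_aeval ((ballNilIdeal K).hasEval x) G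
  have hy := MvPowerSeries.hasSum_aeval ((ballNilIdeal K).hasEval y) G
  have hxy := (hx.sub hy).map (unitBall K).subtype continuous_subtype_val
  rw [Subring.coe_subtype] at hxy
  rw [coe_evalPt, coe_evalPt, ← AddSubgroupClass.coe_sub, ← hxy.tsum_eq]
  refine IsUltrametricDist.norm_tsum_le_of_forall_le_of_nonneg (le_max_of_le_left (norm_nonneg _)) fun d => ?_
  rw [Function.comp_apply, ← smul_sub, Algebra.smul_def]
  push_cast
  refine (norm_coe_algebraMap_mul_le _ _).trans ?_
  have h2 : ∀ z : Fin 2 → (ballNilIdeal K).toIdeal,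
      (d.prod fun i e => ((z i : (ballNilIdeal K).toIdeal) : unitBall K) ^ e) =
        ((z 0 : (ballNilIdeal K).toIdeal) : unitBall K) ^ (d 0) * ((z 1 : (ballNilIdeal K).toIdeal) : unitBall K) ^ (d 1) := by
    intro z
    rw [Finsupp.prod_fintype _ _ (fun i => by rw [pow_zero]), Fin.prod_univ_two]
  have := norm_coe_monomial_two_sub_le (fun i => ((x i : (ballNilIdeal K).toIdeal) : unitBall K))
    (fun i => ((y i : (ballNilIdeal K).toIdeal) : unitBall K)) (d 0) (d 1)
  rw [← h2 x, ← h2 y] at this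
  push_cast at this ⊢
  exact this

end Lipschitz

/-! ## §2 The contraction estimate for `[p]_W` -/

section Contraction

variable {K : Type*} [NontriviallyNormedField K] [IsUltrametricDist K] [CompleteSpace K]
  {p : ℕ} [hp : Fact p.Prime] (W : WeierstrassCurve ℤ)

omit [CompleteSpace K] in
/-- **`‖xᵖ − yᵖ‖ ≤ max(‖p‖·‖x − y‖, ‖x − y‖ᵖ)`** in `𝒪_K` (`(y + ε)ᵖ = yᵖ + εᵖ + p·y·ε·r`, Mathlib `exists_add_pow_prime_eq`).
[cite: SilvermanAEC2009, IV.4.4] -/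
theorem norm_coe_pow_prime_sub_le (x y : unitBall K) :
    ‖((x : K) ^ p - (y : K) ^ p)‖ ≤ max (‖(p : K)‖ * ‖(x : K) - (y : K)‖) (‖(x : K) - (y : K)‖ ^ p) := by
  obtain ⟨r, hr⟩ := exists_add_pow_prime_eq hp.out y (x - y)
  rw [add_sub_cancel] at hr
  have h1 : ((x : K) ^ p - (y : K) ^ p) = ((x : K) - (y : K)) ^ p + (p : K) * (y : K) * ((x : K) - (y : K)) * (r : K) := by
    have := congrArg (fun z : unitBall K => (z : K)) hr
    push_cast at this
    linear_combination this
  rw [h1]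
  refine (IsUltrametricDist.norm_add_le_max _ _).trans ?_
  rw [max_comm, norm_pow]
  refine max_le_max ?_ le_rfl
  rw [norm_mul, norm_mul, norm_mul]
  calc ‖(p : K)‖ * ‖(y : K)‖ * ‖(x : K) - (y : K)‖ * ‖(r : K)‖
      ≤ ‖(p : K)‖ * 1 * ‖(x : K) - (y : K)‖ * 1 := by
        gcongr
        · exact (mem_unitBall_iff K).mp y.2
        · exact (mem_unitBall_iff K).mp r.2
    _ = ‖(p : K)‖ * ‖(x : K) - (y : K)‖ := by ring

/-- `[p]_W(x)` read in `K` through the decomposition `[p] = p·f + g(Xᵖ)`: `[p](x) = p·f(x) + g(x^p)` with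
`x^p` the point `evalPt₁ (Xᵖ) x`. [cite: SilvermanAEC2009, IV.4.4] -/
theorem coe_evalPt₁_formalMul_eq (x : (ballNilIdeal K).toIdeal) :
    (((evalPt₁ (ballNilIdeal K) (W.formalMul p) (W.constantCoeff_formalMul p) x : (ballNilIdeal K).toIdeal) : unitBall K) : K) =
      (p : K) * (evalAt (ballNilIdeal K) x (W.formalMulPRemPartInt (p := p)) : K) +
        (evalAt (ballNilIdeal K) (evalPt₁ (ballNilIdeal K) ((PowerSeries.X : ℤ⟦X⟧) ^ p)
          (by rw [map_pow, PowerSeries.constantCoeff_X, zero_pow hp.out.ne_zero]) x)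
          (W.formalMulPDivPartInt (p := p)) : K) := by
  rw [coe_evalPt₁_eq_evalAt, W.formalMul_prime_eq_add_subst_X_pow_int (p := p), map_add, map_mul, map_natCast,
    evalAt_subst₁]
  push_cast
  rfl

/-- The point `xᵖ`, read in `K`. [cite: CasselsFrohlichANT1967, Ch. VI §3.2] -/
theorem coe_evalPt₁_X_pow (x : (ballNilIdeal K).toIdeal) (n : ℕ) (hn : PowerSeries.constantCoeff ((PowerSeries.X : ℤ⟦X⟧) ^ n) = 0) :
    (((evalPt₁ (ballNilIdeal K) ((PowerSeries.X : ℤ⟦X⟧) ^ n) hn x : (ballNilIdeal K).toIdeal) : unitBall K) : K) =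
      (((x : unitBall K)) : K) ^ n := by
  rw [coe_evalPt₁_eq_evalAt, map_pow, evalAt_X']
  push_cast
  rfl

/-- ★★ **Contraction of `[p]`: `‖[p]x − [p]y‖ ≤ max(‖p‖·‖x − y‖, ‖x − y‖ᵖ)`** for `x, y ∈ Ŵ(𝔪_K)` (AEC IV.4.4 over `ℤ`:
`[p] = p·f + g(Xᵖ)`, `f, g` integral and `1`-Lipschitz). [cite: SilvermanAEC2009, IV.4.4] -/
theorem norm_formalMul_sub_le_max (x y : (ballNilIdeal K).toIdeal) :
    ‖(((evalPt₁ (ballNilIdeal K) (W.formalMul p) (W.constantCoeff_formalMul p) x : (ballNilIdeal K).toIdeal) : unitBall K) : K) -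
        (((evalPt₁ (ballNilIdeal K) (W.formalMul p) (W.constantCoeff_formalMul p) y : (ballNilIdeal K).toIdeal) : unitBall K) : K)‖ ≤
      max (‖(p : K)‖ * ‖(((x : unitBall K)) : K) - ((y : unitBall K) : K)‖) (‖(((x : unitBall K)) : K) - ((y : unitBall K) : K)‖ ^ p) := by
  have hXp : PowerSeries.constantCoeff ((PowerSeries.X : ℤ⟦X⟧) ^ p) = 0 := by
    rw [map_pow, PowerSeries.constantCoeff_X, zero_pow hp.out.ne_zero]
  rw [coe_evalPt₁_formalMul_eq W x, coe_evalPt₁_formalMul_eq W y]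
  have hsplit : ∀ a b c d : K, (p : K) * a + b - ((p : K) * c + d) = (p : K) * (a - c) + (b - d) := fun a b c d => by ring
  rw [hsplit]
  refine (IsUltrametricDist.norm_add_le_max _ _).trans (max_le ?_ ?_)
  · rw [norm_mul]
    exact le_max_of_le_left (mul_le_mul_of_nonneg_left (norm_evalAt_sub_evalAt_le x y _) (norm_nonneg _))
  · refine (norm_evalAt_sub_evalAt_le _ _ _).trans ?_
    rw [coe_evalPt₁_X_pow x p hXp, coe_evalPt₁_X_pow y p hXp]
    exact norm_coe_pow_prime_sub_le (x : unitBall K) (y : unitBall K)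

omit [CompleteSpace K] hp in
/-- `‖p‖ ≤ 1` in `K`. [folklore] -/
private theorem norm_natCast_prime_le_one : ‖(p : K)‖ ≤ 1 := IsUltrametricDist.norm_natCast_le_one K p

omit hp in
/-- `[p]` is `1`-Lipschitz on `Ŵ(𝔪_K)`. [cite: SilvermanAEC2009, IV.3.2] -/
theorem norm_formalMul_sub_le (x y : (ballNilIdeal K).toIdeal) :
    ‖(((evalPt₁ (ballNilIdeal K) (W.formalMul p) (W.constantCoeff_formalMul p) x : (ballNilIdeal K).toIdeal) : unitBall K) : K) -
        (((evalPt₁ (ballNilIdeal K) (W.formalMul p) (W.constantCoeff_formalMul p) y : (ballNilIdeal K).toIdeal) : unitBall K) : K)‖ ≤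
      ‖(((x : unitBall K)) : K) - ((y : unitBall K) : K)‖ :=
  norm_evalPt₁_sub_evalPt₁_le _ _ x y

/-- ★ **Iterated contraction: `‖[p]ᵏx − [p]ᵏy‖ ≤ ρᵏ·δ`** with `ρ = max(‖p‖, δ^{p−1})` whenever `‖x − y‖ ≤ δ`; together with
`‖[p]ᵏx − [p]ᵏy‖ ≤ δ` (`[p]` is `1`-Lipschitz). [cite: SilvermanAEC2009, IV.4.4] -/
theorem norm_iterate_formalMul_sub_le {δ : ℝ} (x y : (ballNilIdeal K).toIdeal)
    (hxy : ‖(((x : unitBall K)) : K) - ((y : unitBall K) : K)‖ ≤ δ) (k : ℕ) :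
    ‖((((evalPt₁ (ballNilIdeal K) (W.formalMul p) (W.constantCoeff_formalMul p))^[k] x : (ballNilIdeal K).toIdeal) : unitBall K) : K) -
        ((((evalPt₁ (ballNilIdeal K) (W.formalMul p) (W.constantCoeff_formalMul p))^[k] y : (ballNilIdeal K).toIdeal) : unitBall K) : K)‖ ≤
      (max ‖(p : K)‖ (δ ^ (p - 1))) ^ k * δ ∧
    ‖((((evalPt₁ (ballNilIdeal K) (W.formalMul p) (W.constantCoeff_formalMul p))^[k] x : (ballNilIdeal K).toIdeal) : unitBall K) : K) -
        ((((evalPt₁ (ballNilIdeal K) (W.formalMul p) (W.constantCoeff_formalMul p))^[k] y : (ballNilIdeal K).toIdeal) : unitBall K) : K)‖ ≤ δ := by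
  have hδ0 : 0 ≤ δ := (norm_nonneg _).trans hxy
  set P := evalPt₁ (ballNilIdeal K) (W.formalMul p) (W.constantCoeff_formalMul p) with hP
  set ρ : ℝ := max ‖(p : K)‖ (δ ^ (p - 1)) with hρ
  have hρ0 : 0 ≤ ρ := le_max_of_le_left (norm_nonneg _)
  induction k with
  | zero => simpa using hxy
  | succ k ih =>
    obtain ⟨ih1, ih2⟩ := ih
    rw [Function.iterate_succ_apply', Function.iterate_succ_apply']
    refine ⟨(norm_formalMul_sub_le_max W _ _).trans (max_le ?_ ?_), (norm_formalMul_sub_le W _ _).trans ih2⟩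
    · calc ‖(p : K)‖ * _ ≤ ρ * (ρ ^ k * δ) := mul_le_mul (le_max_left _ _) ih1 (norm_nonneg _) hρ0
        _ = ρ ^ (k + 1) * δ := by ring
    · have hp1 : p = (p - 1) + 1 := (Nat.sub_add_cancel hp.out.one_le).symm
      calc _ = _ ^ (p - 1) * _ ^ 1 := by rw [← pow_add, ← hp1]
        _ ≤ δ ^ (p - 1) * (ρ ^ k * δ) := by
          rw [pow_one]
          exact mul_le_mul (pow_le_pow_left₀ (norm_nonneg _) ih2 _) ih1 (norm_nonneg _) (pow_nonneg hδ0 _)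
        _ ≤ ρ * (ρ ^ k * δ) := mul_le_mul_of_nonneg_right (le_max_right _ _) (mul_nonneg (pow_nonneg hρ0 _) hδ0)
        _ = ρ ^ (k + 1) * δ := by ring

end Contraction

/-! ## §3 Saturation: existence and uniqueness of the exact division sequence near an approximate one -/

section Saturation

variable {K : Type*} [NontriviallyNormedField K] [IsUltrametricDist K] [CompleteSpace K]
  {p : ℕ} [hp : Fact p.Prime] (W : WeierstrassCurve ℤ)

omit [IsUltrametricDist K] [CompleteSpace K] in
/-- The contraction ratio `ρ = max(‖p‖, δ^{p−1}) < 1` for `δ < 1` when `‖p‖ < 1` in `K` (e.g. `K = ℂ_F` for a `p`-adic field `F`).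
[cite: SilvermanAEC2009, IV.4.4] -/
theorem max_norm_prime_pow_lt_one (hpK : ‖(p : K)‖ < 1) {δ : ℝ} (hδ0 : 0 ≤ δ) (hδ : δ < 1) :
    max ‖(p : K)‖ (δ ^ (p - 1)) < 1 :=
  max_lt hpK (pow_lt_one₀ hδ0 hδ (Nat.sub_ne_zero_of_lt hp.out.one_lt))

/-- **The tower of iterates `aₙ(k) := [p]ᵏ(v_{n+k})` is Cauchy at a geometric rate**: `‖aₙ(k+1) − aₙ(k)‖ ≤ ρᵏ·δ` if
`‖[p]v_{m+1} − v_m‖ ≤ δ` for all `m`. [cite: Colmez1992PeriodesAbeliennes, §2] -/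
theorem norm_iterate_succ_sub_iterate_le {δ : ℝ} (v : ℕ → (ballNilIdeal K).toIdeal)
    (hv : ∀ m, ‖(((evalPt₁ (ballNilIdeal K) (W.formalMul p) (W.constantCoeff_formalMul p) (v (m + 1)) : (ballNilIdeal K).toIdeal) :
      unitBall K) : K) - (((v m : (ballNilIdeal K).toIdeal) : unitBall K) : K)‖ ≤ δ) (n k : ℕ) :
    ‖((((evalPt₁ (ballNilIdeal K) (W.formalMul p) (W.constantCoeff_formalMul p))^[k + 1] (v (n + (k + 1))) :
        (ballNilIdeal K).toIdeal) : unitBall K) : K) -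
      ((((evalPt₁ (ballNilIdeal K) (W.formalMul p) (W.constantCoeff_formalMul p))^[k] (v (n + k)) :
        (ballNilIdeal K).toIdeal) : unitBall K) : K)‖ ≤ (max ‖(p : K)‖ (δ ^ (p - 1))) ^ k * δ := by
  rw [Function.iterate_succ_apply, show n + (k + 1) = n + k + 1 by ring]
  exact (norm_iterate_formalMul_sub_le W _ _ (hv (n + k)) k).1

/-- The iterates stay `δ`-close to `v_n`: `‖[p]ᵏ(v_{n+k}) − v_n‖ ≤ δ` (ultrametric telescoping).
[cite: Colmez1992PeriodesAbeliennes, §2] -/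
theorem norm_iterate_sub_self_le {δ : ℝ} (hδ : δ < 1) (hpK : ‖(p : K)‖ < 1) (v : ℕ → (ballNilIdeal K).toIdeal)
    (hv : ∀ m, ‖(((evalPt₁ (ballNilIdeal K) (W.formalMul p) (W.constantCoeff_formalMul p) (v (m + 1)) : (ballNilIdeal K).toIdeal) :
      unitBall K) : K) - (((v m : (ballNilIdeal K).toIdeal) : unitBall K) : K)‖ ≤ δ) (n k : ℕ) :
    ‖((((evalPt₁ (ballNilIdeal K) (W.formalMul p) (W.constantCoeff_formalMul p))^[k] (v (n + k)) :
        (ballNilIdeal K).toIdeal) : unitBall K) : K) - (((v n : (ballNilIdeal K).toIdeal) : unitBall K) : K)‖ ≤ δ := by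
  have hδ0 : 0 ≤ δ := (norm_nonneg _).trans (hv 0)
  have hρ0 : 0 ≤ max ‖(p : K)‖ (δ ^ (p - 1)) := le_max_of_le_left (norm_nonneg _)
  have hρ1 : max ‖(p : K)‖ (δ ^ (p - 1)) ≤ 1 := (max_norm_prime_pow_lt_one hpK hδ0 hδ).le
  induction k with
  | zero => simp [hδ0]
  | succ k ih =>
    have hstep := norm_iterate_succ_sub_iterate_le W v hv n k
    have hsplit : ∀ a b c : K, a - c = (a - b) + (b - c) := fun a b c => by ring
    rw [hsplit _ ((((evalPt₁ (ballNilIdeal K) (W.formalMul p) (W.constantCoeff_formalMul p))^[k] (v (n + k)) :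
        (ballNilIdeal K).toIdeal) : unitBall K) : K)]
    refine (IsUltrametricDist.norm_add_le_max _ _).trans (max_le (hstep.trans ?_) ih)
    calc (max ‖(p : K)‖ (δ ^ (p - 1))) ^ k * δ ≤ 1 ^ k * δ := by gcongr
      _ = δ := by rw [one_pow, one_mul]

/-- ★★ **SATURATION (existence)**: if `‖[p]v_{n+1} − v_n‖ ≤ δ < 1` for all `n` (an APPROXIMATE `[p]_W`-division sequence
of `Ŵ(𝔪_K)`), then there is an EXACT `[p]_W`-division sequence `w` (`[p]w_{n+1} = w_n`) with `‖w_n − v_n‖ ≤ δ` for all `n`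
(`w_n = lim_k [p]ᵏ(v_{n+k})`). [cite: Colmez1992PeriodesAbeliennes, §2] [cite: SilvermanAEC2009, IV.4.4] -/
theorem exists_divisionSeq_norm_sub_le (hpK : ‖(p : K)‖ < 1) {δ : ℝ} (hδ : δ < 1) (v : ℕ → (ballNilIdeal K).toIdeal)
    (hv : ∀ m, ‖(((evalPt₁ (ballNilIdeal K) (W.formalMul p) (W.constantCoeff_formalMul p) (v (m + 1)) : (ballNilIdeal K).toIdeal) :
      unitBall K) : K) - (((v m : (ballNilIdeal K).toIdeal) : unitBall K) : K)‖ ≤ δ) :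
    ∃ w : ℕ → (ballNilIdeal K).toIdeal,
      (∀ n, evalPt₁ (ballNilIdeal K) (W.formalMul p) (W.constantCoeff_formalMul p) (w (n + 1)) = w n) ∧
      ∀ n, ‖(((w n : (ballNilIdeal K).toIdeal) : unitBall K) : K) - (((v n : (ballNilIdeal K).toIdeal) : unitBall K) : K)‖ ≤ δ := by
  have hδ0 : 0 ≤ δ := (norm_nonneg _).trans (hv 0)
  set P := evalPt₁ (ballNilIdeal K) (W.formalMul p) (W.constantCoeff_formalMul p) with hP
  set ρ : ℝ := max ‖(p : K)‖ (δ ^ (p - 1)) with hρ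
  have hρ1 : ρ < 1 := max_norm_prime_pow_lt_one hpK hδ0 hδ
  -- the towers `aₙ(k) = [p]ᵏ(v_{n+k})`, read in `K`
  obtain ⟨a, ha⟩ : ∃ a : ℕ → ℕ → K, ∀ n k, a n k = (((P^[k] (v (n + k)) : (ballNilIdeal K).toIdeal) : unitBall K) : K) :=
    ⟨_, fun _ _ => rfl⟩
  have hcauchy : ∀ n, CauchySeq (a n) := fun n => by
    refine cauchySeq_of_le_geometric ρ δ hρ1 fun k => ?_
    rw [dist_comm, dist_eq_norm, ha, ha, mul_comm]
    exact norm_iterate_succ_sub_iterate_le W v hv n k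
  -- limits
  obtain ⟨L, hL⟩ : ∃ L : ℕ → K, ∀ n, Tendsto (a n) atTop (𝓝 (L n)) :=
    ⟨fun n => Classical.choose (cauchySeq_tendsto_of_complete (hcauchy n)),
      fun n => Classical.choose_spec (cauchySeq_tendsto_of_complete (hcauchy n))⟩
  have hclose : ∀ n, ‖L n - (((v n : (ballNilIdeal K).toIdeal) : unitBall K) : K)‖ ≤ δ := fun n => by
    have ht : Tendsto (fun k => ‖a n k - (((v n : (ballNilIdeal K).toIdeal) : unitBall K) : K)‖) atTop
        (𝓝 ‖L n - (((v n : (ballNilIdeal K).toIdeal) : unitBall K) : K)‖) :=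
      (continuous_norm.tendsto _).comp ((hL n).sub_const _)
    exact le_of_tendsto' ht fun k => by rw [ha]; exact norm_iterate_sub_self_le W hδ hpK v hv n k
  have hLlt : ∀ n, ‖L n‖ < 1 := fun n => by
    have hsplit : L n = (L n - (((v n : (ballNilIdeal K).toIdeal) : unitBall K) : K)) +
        (((v n : (ballNilIdeal K).toIdeal) : unitBall K) : K) := by ring
    rw [hsplit]
    exact (IsUltrametricDist.norm_add_le_max _ _).trans_lt (max_lt ((hclose n).trans_lt hδ) (v n).2)
  refine ⟨fun n => mkBallPt (L n) (hLlt n), fun n => ?_, fun n => ?_⟩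
  · -- exactness: `[p]` is continuous (`1`-Lipschitz) and `[p](a_{n+1}(k)) = aₙ(k+1)`
    apply Subtype.ext; apply Subtype.ext
    change (((P (mkBallPt (L (n + 1)) (hLlt (n + 1))) : (ballNilIdeal K).toIdeal) : unitBall K) : K) = L n
    have h1 : Tendsto (fun k => (((P (P^[k] (v (n + 1 + k))) : (ballNilIdeal K).toIdeal) : unitBall K) : K)) atTop
        (𝓝 ((((P (mkBallPt (L (n + 1)) (hLlt (n + 1))) : (ballNilIdeal K).toIdeal) : unitBall K) : K))) := by
      rw [tendsto_iff_norm_sub_tendsto_zero]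
      refine squeeze_zero (fun _ => norm_nonneg _) (fun k => norm_formalMul_sub_le W _ _) ?_
      have h2 : Tendsto (fun k => a (n + 1) k - L (n + 1)) atTop (𝓝 0) := by
        rw [← sub_self (L (n + 1))]
        exact (hL (n + 1)).sub_const _
      have h3 := tendsto_norm_zero.comp h2
      refine h3.congr fun k => ?_
      rw [Function.comp_apply, ha]
      rfl
    have h4 : (fun k => (((P (P^[k] (v (n + 1 + k))) : (ballNilIdeal K).toIdeal) : unitBall K) : K)) = fun k => a n (k + 1) := by
      funext k
      rw [ha, Function.iterate_succ_apply', show n + (k + 1) = n + 1 + k by ring]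
    rw [h4] at h1
    exact tendsto_nhds_unique h1 ((hL n).comp (tendsto_add_atTop_nat 1))
  · exact hclose n

/-- ★★ **SATURATION (uniqueness) / RIGIDITY of `[p]`-towers**: two EXACT `[p]_W`-division sequences of `Ŵ(𝔪_K)` which are
termwise `δ`-close for some `δ < 1` are equal (`‖w_n − w'_n‖ = ‖[p]ᵏw_{n+k} − [p]ᵏw'_{n+k}‖ ≤ ρᵏδ → 0`).
[cite: Colmez1992PeriodesAbeliennes, §2] [cite: SilvermanAEC2009, IV.4.4] -/
theorem divisionSeq_unique_of_norm_sub_le (hpK : ‖(p : K)‖ < 1) {δ : ℝ} (hδ : δ < 1) (w w' : ℕ → (ballNilIdeal K).toIdeal)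
    (hw : ∀ n, evalPt₁ (ballNilIdeal K) (W.formalMul p) (W.constantCoeff_formalMul p) (w (n + 1)) = w n)
    (hw' : ∀ n, evalPt₁ (ballNilIdeal K) (W.formalMul p) (W.constantCoeff_formalMul p) (w' (n + 1)) = w' n)
    (h : ∀ n, ‖(((w n : (ballNilIdeal K).toIdeal) : unitBall K) : K) - (((w' n : (ballNilIdeal K).toIdeal) : unitBall K) : K)‖ ≤ δ) :
    w = w' := by
  have hδ0 : 0 ≤ δ := (norm_nonneg _).trans (h 0)
  set P := evalPt₁ (ballNilIdeal K) (W.formalMul p) (W.constantCoeff_formalMul p) with hP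
  have hρ1 : max ‖(p : K)‖ (δ ^ (p - 1)) < 1 := max_norm_prime_pow_lt_one hpK hδ0 hδ
  have hiter : ∀ (u : ℕ → (ballNilIdeal K).toIdeal), (∀ n, P (u (n + 1)) = u n) → ∀ n k, P^[k] (u (n + k)) = u n := by
    intro u hu n k
    induction k with
    | zero => simp
    | succ k ih => rw [Function.iterate_succ_apply, show n + (k + 1) = n + k + 1 by ring, hu, ih]
  funext n
  apply Subtype.ext; apply Subtype.ext
  have hbound : ∀ k, ‖(((w n : (ballNilIdeal K).toIdeal) : unitBall K) : K) - (((w' n : (ballNilIdeal K).toIdeal) : unitBall K) : K)‖ ≤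
      (max ‖(p : K)‖ (δ ^ (p - 1))) ^ k * δ := fun k => by
    rw [← hiter w hw n k, ← hiter w' hw' n k]
    exact (norm_iterate_formalMul_sub_le W _ _ (h (n + k)) k).1
  have hlim : Tendsto (fun k => (max ‖(p : K)‖ (δ ^ (p - 1))) ^ k * δ) atTop (𝓝 0) := by
    simpa using (tendsto_pow_atTop_nhds_zero_of_lt_one (le_max_of_le_left (norm_nonneg _)) hρ1).mul_const δ
  have h0 : ‖(((w n : (ballNilIdeal K).toIdeal) : unitBall K) : K) - (((w' n : (ballNilIdeal K).toIdeal) : unitBall K) : K)‖ ≤ 0 :=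
    ge_of_tendsto hlim (Eventually.of_forall hbound)
  exact sub_eq_zero.1 (norm_le_zero_iff.1 h0)

end Saturation

end Literature.NumberTheory.PAdicHodge
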